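import Mathlib
import HarnessLib
import Literature.MathematicalPhysics.QuantumLattice.GrassmannDefectSplit
import Summits.HubbardSuperconductivity.HubbardSuperconductivity.Theorems.KLProgrammeKLRegimeWickDressedStep

/-!
# Route `KLProgramme` — crux K3, ENGINE child (stmt-HubbardSuperconductivity-20236 / gen-7-flow successor), stub `stub_engine_step_values`, conjunct
# (E2-v10)/(E2-F): the DRESSED vertex in terms of the history object `𝒲_n` — the grid re-ordering identities of organisation (R1′)

Cell gate-hubbard-kl, seat hubbard-kl-p1 (g10; (E2) Wick-toolkit lane).  In the dressed Wick step `klw_wickAction_succ_dressed` (p524233) both vertices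
are `W̃ = e^{Δ_{D^m + g̃}}V′` with `V′ = 𝒱_n − Q`, whereas the history supplies the Wick kernels of `𝒲_n = e^{Δ_{D_n}}𝒱_n`.  The two are related by ONE
finite re-Wick-ordering by the «dressing defect» covariance `E := (D^m + g̃) − D_n` and the removal of the (Gaussian-smeared) two-leg part:

* (generic) `gaussConv_eq_gaussConv_sub_gaussConv` — `e^{Δ_A} = e^{Δ_{A−B}} ∘ e^{Δ_B}`; `gaussConv_sum_smul_gen_mul_gen` — the Gaussian smearing of a
  presented quadratic element only adds a constant: `e^{Δ_C}(Σ_i κ_i ψ(X_i)ψ(Y_i)) = Σ_i κ_i ψ(X_i)ψ(Y_i) + algebraMap(Σ_i κ_i·½(C(Y_i,X_i) − C(X_i,Y_i)))`;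
* (model) **`klw_dressedVertex_eq_reorder`** — `e^{Δ_{D^m+g̃}}V′ = e^{Δ_{(D^m+g̃) − D_n}}(𝒲_n − e^{Δ_{D_n}}Q)` and, with `Q = Σ_{kσ} κ(k,σ)ψ̂⁺_{kσ}ψ̂⁻_{kσ}`,
  **`klw_gaussConv_twoLegPart`** — `e^{Δ_{D_n}}Q = Q + algebraMap(Σ_{kσ} κ(k,σ)·½(D_n(ψ̂⁻,ψ̂⁺) − D_n(ψ̂⁺,ψ̂⁻)))` — so the dressed vertex is the
  `E`-smearing of `𝒲_n − Q` up to a constant (constants are invisible to every kernel of degree ≥ 1 and to `dblFold`-contractions of them):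
  the (E2) prover reads `W̃`'s kernels from the history's `𝒲_n` by `E`-contractions of `𝒲_{n,≥4}` (k3c1-p1's request, KL STATUS 10:35:54Z
  «grid re-ordering identities»).

Exact algebra; nothing about sizes or superconductivity is asserted.  0 kit.
-/

noncomputable section

namespace Summit.HubbardSuperconductivity.HubbardSuperconductivity.Theorems.KLRegimeWick

set_option linter.dupNamespace false -- summit = problem name (single-conjunct summit), D-0017

open Literature.MathematicalPhysics.QuantumLattice GrassmannAlgebra Finset Matrix
open Literature.Probability.LatticeModels
open Summit.HubbardSuperconductivity.HubbardSuperconductivity.Theorems.KLProgrammeLegKernels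
open Summit.HubbardSuperconductivity.HubbardSuperconductivity.Theorems.KLRegimeSplit

/-! ## §1 Generic -/

section Generic

variable {R : Type*} [CommRing R] [Algebra ℚ R] {Γ : Type*} [Fintype Γ] [DecidableEq Γ]

omit [DecidableEq Γ] in
/-- `e^{Δ_A} x = e^{Δ_{A − B}}(e^{Δ_B} x)`: re-Wick-ordering from `B` to `A` is a Gaussian smearing by the difference. -/
theorem gaussConv_eq_gaussConv_sub_gaussConv (A B : Matrix Γ Γ R) (x : GrassmannAlgebra R Γ) :
    gaussConv R A x = gaussConv R (A - B) (gaussConv R B x) := by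
  rw [← gaussConv_add_apply, sub_add_cancel]

/-- **Gaussian smearing of a presented quadratic element adds a constant**:
`e^{Δ_C}(Σ_i κ_i ψ(X_i)ψ(Y_i)) = Σ_i κ_i ψ(X_i)ψ(Y_i) + algebraMap (Σ_i κ_i·½(C(Y_i,X_i) − C(X_i,Y_i)))` (`gaussConv_gen_mul_gen` summed). -/
theorem gaussConv_sum_smul_gen_mul_gen {ι : Type*} (s : Finset ι) (C : Matrix Γ Γ R) (κ : ι → R) (X Y : ι → Γ) :
    gaussConv R C (∑ i ∈ s, κ i • (gen R (X i) * gen R (Y i))) =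
      ∑ i ∈ s, κ i • (gen R (X i) * gen R (Y i)) +
        algebraMap R (GrassmannAlgebra R Γ) (∑ i ∈ s, κ i * (((1 / 2 : ℚ) • (1 : R)) * (C (Y i) (X i) - C (X i) (Y i)))) := by
  rw [map_sum, map_sum, ← Finset.sum_add_distrib]
  refine Finset.sum_congr rfl fun i _ => ?_
  rw [map_smul, gaussConv_gen_mul_gen, smul_add, Algebra.smul_def, Algebra.smul_def, ← RingHom.map_mul]

end Generic

/-! ## §2 Model: the dressed vertex read from the history object `𝒲_n` -/

section Model

variable (L M : ℕ) [NeZero L] [NeZero M] (β U μ : ℝ) (K : TrigPolyC4v)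

omit [NeZero M] in
/-- **`klw_dressedVertex_eq_reorder`** — with `V′ = 𝒱_n − Q`: `e^{Δ_{D^m+g̃}}V′ = e^{Δ_{(D^m+g̃) − D_n}}(𝒲_n − e^{Δ_{D_n}}Q)` (`𝒲_n = e^{Δ_{D_n}}𝒱_n` the history's
Wick-smeared action): the dressed vertex of `klw_wickAction_succ_dressed` is ONE re-ordering by the dressing defect `E = (D^m+g̃) − D_n` away from
`𝒲_n` minus the smeared two-leg part. -/
theorem klw_dressedVertex_eq_reorder (n : ℕ) (Q V' : HubbardGrassmann L M) (gt Dm : Matrix (HubbardFieldIdx L M) (HubbardFieldIdx L M) ℂ)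
    (hV' : V' = klEffectiveAction L M β U μ K klE0 n - Q) :
    gaussConv ℂ (Dm + gt) V' =
      gaussConv ℂ (Dm + gt - klSoftCov L M β μ K n) (klWickAction L M β U μ K n - gaussConv ℂ (klSoftCov L M β μ K n) Q) := by
  rw [hV', klWickAction, ← map_sub, ← gaussConv_eq_gaussConv_sub_gaussConv, map_sub]

omit [NeZero M] in
/-- **`klw_gaussConv_twoLegPart`** — the Gaussian smearing of the diagonal two-leg part `Q = Σ_{kσ} κ(k,σ)ψ̂⁺_{kσ}ψ̂⁻_{kσ}` by ANY covariance `C` only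
adds a constant: `e^{Δ_C}Q = Q + algebraMap(Σ_{kσ} κ(k,σ)·½(C(ψ̂⁻_{kσ},ψ̂⁺_{kσ}) − C(ψ̂⁺_{kσ},ψ̂⁻_{kσ})))` — in particular `e^{Δ_{D_n}}Q` and `Q` have
the same kernels in every degree `≥ 1`. -/
theorem klw_gaussConv_twoLegPart (C : Matrix (HubbardFieldIdx L M) (HubbardFieldIdx L M) ℂ) (κ : FreqMomentum L M × Fin 2 → ℂ)
    (Q : HubbardGrassmann L M)
    (hQ : Q = ∑ ks : FreqMomentum L M × Fin 2, κ ks • (gen ℂ ((ks, 0) : HubbardFieldIdx L M) * gen ℂ ((ks, 1) : HubbardFieldIdx L M))) :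
    gaussConv ℂ C Q =
      Q + algebraMap ℂ (HubbardGrassmann L M)
        (∑ ks : FreqMomentum L M × Fin 2, κ ks * (((1 / 2 : ℚ) • (1 : ℂ)) *
          (C ((ks, 1) : HubbardFieldIdx L M) ((ks, 0) : HubbardFieldIdx L M) - C ((ks, 0) : HubbardFieldIdx L M) ((ks, 1) : HubbardFieldIdx L M)))) := by
  rw [hQ]
  exact gaussConv_sum_smul_gen_mul_gen Finset.univ C κ (fun ks => ((ks, 0) : HubbardFieldIdx L M)) (fun ks => ((ks, 1) : HubbardFieldIdx L M))

omit [NeZero L] [NeZero M] in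
/-- Constants have no kernels of positive degree. -/
theorem kernel_algebraMap_succ (r : ℂ) {m : ℕ} (X : Fin (m + 1) → HubbardFieldIdx L M) :
    kernel ℂ (algebraMap ℂ (HubbardGrassmann L M) r) (m + 1) X = 0 := by
  rw [kernel_def, iterDeriv_succ_apply, grassmannDeriv_algebraMap, map_zero, map_zero, mul_zero]

omit [NeZero M] in
/-- **Kernels of the dressed vertex from the history** (degrees `≥ 1`): `kernel_{m+1}(e^{Δ_{D^m+g̃}}V′) = kernel_{m+1}(e^{Δ_E}(𝒲_n − Q))`, `E = (D^m+g̃) − D_n`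
— the smeared two-leg part and `Q` differ by a constant, which no kernel of positive degree sees (and Gaussian smearing fixes constants). -/
theorem klw_kernel_dressedVertex_eq (n : ℕ) (κ : FreqMomentum L M × Fin 2 → ℂ) (Q V' : HubbardGrassmann L M)
    (gt Dm : Matrix (HubbardFieldIdx L M) (HubbardFieldIdx L M) ℂ)
    (hQ : Q = ∑ ks : FreqMomentum L M × Fin 2, κ ks • (gen ℂ ((ks, 0) : HubbardFieldIdx L M) * gen ℂ ((ks, 1) : HubbardFieldIdx L M)))
    (hV' : V' = klEffectiveAction L M β U μ K klE0 n - Q) {m : ℕ} (X : Fin (m + 1) → HubbardFieldIdx L M) :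
    kernel ℂ (gaussConv ℂ (Dm + gt) V') (m + 1) X =
      kernel ℂ (gaussConv ℂ (Dm + gt - klSoftCov L M β μ K n) (klWickAction L M β U μ K n - Q)) (m + 1) X := by
  rw [klw_dressedVertex_eq_reorder L M β U μ K n Q V' gt Dm hV', klw_gaussConv_twoLegPart L M (klSoftCov L M β μ K n) κ Q hQ, ← sub_sub,
    map_sub (gaussConv ℂ (Dm + gt - klSoftCov L M β μ K n)) (klWickAction L M β U μ K n - Q), gaussConv_algebraMap, kernel_sub' ℂ,
    kernel_algebraMap_succ, sub_zero]

end Model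

end Summit.HubbardSuperconductivity.HubbardSuperconductivity.Theorems.KLRegimeWick

end
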